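import Summits.ABC.IUTFork.Cor312Loci
import Summits.ABC.IUTFork.Cor312Obs
import HarnessLib

/-!
# [IUTchIII] Corollary 3.12 — the proof's twenty steps as a typed chain over the signature (c312 crew, III)

Record-only file (D-0012) of the abc-iut cell; TAKES NO SIDE. Over the vocabulary of `Cor312Loci.lean`
(the 85 cited sub-item loci, `Locus`) and `Cor312Obs.lean` (the 36 assertions the proof itself makes,
`Obs`), this file types the proof of [IUTchIII] Cor. 3.12 (author's kurims 2020 text
`paper:url-4b091feeb646`, p. 174 l. 20 – p. 186 l. 3, READ ON THE PAGE) as a finite DAG: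

* `Step` — the twenty printed nodes: the opening paragraph, Steps (i)–(x), Substeps (xi-a)–(xi-h), Step
  (xii) (the cell's plan/STATEMENT-CLOSURE.md §B counts 19, folding (xi-h) into (xi-g)). Docstring =
  page/line, §B word count, and the gist in the author's words.
* `Step.data` — for each node, READ ON THE PAGE: the loci it cites (`cites`), the earlier nodes it refers
  back to (`after`: "[cf. (i)]", "In the context of (v)", "we conclude from (xi-e)"), the earlier
  observations it invokes (`uses`) and the observations it draws (`concl`). Machine-checked (`decide`):
  the back-references point backwards (`after_lt`), every invoked observation was concluded by a node
  referred back to (`uses_supplied`), every observation is concluded by exactly one node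
  (`concl_unique`), every locus is cited by the statement or some node (`cites_cover`), and the per-node
  citation counts (`cites_lengths`, beside §B's regex counts).
* `Step.Holds L O` — the node as an INFERENCE under a reading `L : Locus → Prop`, `O : Obs → Prop`:
  "if the cited loci hold and the invoked earlier observations hold, the node's observations hold";
  `Chain L O` — all twenty hold. PROVED: `obs_of_chain` — granting every cited locus, the chain yields
  every observation (induction along the DAG), in particular (xi-f)'s "subject to the condition …
  constitutes … a construction … of `−|log(q)|`" (`Obs.constitutesConstruction`); `chain_of_grant` /
  `not_chain_denying_xi_f` — the chain is satisfiable and not vacuous.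

What this level does NOT contain is any real number: Mochizuki [cite: Mochizuki2022EssLgc, §3.6 (Syp3)/(∧-Chn), printed p. 104 = PDF p. 105]
"(Syp3) a desire to see the inequality of the final numerical estimate obtained as the result of
concatenating some chain of intermediate inequalities … (∧-Chn) the logical structure … proceeds by
observing a chain of AND relations "∧"" — read here as data: the twenty nodes carry no inequality; the
passage to `ℝ` ("`ℝ_{≤−|log(Θ)|} ⊆ ℝ; −|log(q)| ∈ ℝ`", (xi-d); "then follows formally", (xi-f)) is typed
in the sibling `Cor312Chain.lean` as named edges, where the three printed readings attach.
[claim: Mochizuki2012, status: disputed] Deliberately NOT here: what any locus says; any judgement.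
-/

namespace Summit.ABC

namespace IUTFork

namespace Cor312Proof

open Locus Obs

/-! ## 1. The twenty nodes -/

/-- The printed nodes of the proof of [IUTchIII] Cor. 3.12 (kurims pp. 174–186; §B = the cell's
plan/STATEMENT-CLOSURE.md §B word counts). [claim: Mochizuki2012, status: disputed] -/
inductive Step
  /-- Opening paragraph, p. 174 l. 20 – p. 175 l. 13 (§B: 374 w). "since `|log(q)| > 0`, we may assume
  without loss of generality … that `−|log(Θ)| < 0` whenever `−|log(Θ)| ∈ ℝ`"; the collections
  `^{n,∘}U = {^{n,∘}U_{j,v_Q}}` of unions of possible images of a Θ-pilot object "subject to the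
  indeterminacies (Ind1), (Ind2), (Ind3)" inside `^{n,∘}U^Q_{j,v_Q} := I^Q(^{S±_{j+1}};^{n,∘}D^⊢_{v_Q})` and
  their holomorphic hulls; "compactness of the `^{1,∘}U_{j,v_Q}` … the quantity `−|log(Θ)|` is finite,
  hence negative"; restriction to possible images interpretable as an `F^{⊩▶}`-prime-strip. Span note
  (ref PASS-R7 F4): `cites` includes `chI_def3_1_b` for "since `|log(q)| > 0`" (p. 174 l. 20), which re-invokes
  the statement's clause p. 174 l. 15–17; the bracketed citation itself lies in the statement (`statementCites`). -/
  | wlog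
  /-- (i) p. 175 l. 19–49 (§B: 107 w): "we concentrate on a single arrow", the Θ×μ_LGP-link
  `^{0,0}HT ⟶ ^{1,0}HT` = full poly-isomorphism `^{0,0}F^{⊩▶×μ}_{LGP} ⥲ ^{1,0}F^{⊩▶×μ}_△`, with its unit
  portion (`F^{⊢×μ}`) and value group portion (`F^{⊩▶}`); the latter maps Θ-pilot to `q`-pilot objects. -/
  | i
  /-- (ii) p. 175 l. 50 – p. 176 l. 17 incl. Fig. 3.6 (§B: 200 w): units subject to (Ind1), (Ind2);
  cyclotomes of the value group portion insulated, by mono-theta cyclotomic rigidity ([EtTh]) resp.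
  [IUTchI] Ex. 5.1 (v), Def. 5.2 (vi), (viii). -/
  | ii
  /-- (iii) p. 176 l. 18–33 (§B: 143 w): unit and value group portions must be related via ONE
  Θ×μ_LGP-link (non-commutativity of the log-theta-lattice). -/
  | iii
  /-- (iv) p. 176 l. 34 – p. 177 l. 8 (§B: 198 w): bi-coricity of the units needs vertically
  once-shifted units; resolved by vertical-shift-invariant structures + log-Kummer, at the cost of (Ind3). -/
  | iv
  /-- (v) p. 177 l. 9–34 (§B: 214 w): relate the units via the unit portion of the link and bi-coricity;
  mono-analytic log-shells as "multiradial mono-analytic containers"; local units, splitting monoids,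
  global Frobenioids at `(0,m)` related to the `(0,∘)` containers by the log-Kummer correspondences. -/
  | v
  /-- (vi) p. 177 l. 35 – p. 179 l. 18 incl. Fig. 3.7 (§B: 778 w): where the log-Kummer correspondences
  come from (Galois evaluation; [IUTchII] §3; [EtTh]: discrete rigidity, isomorphism class compatibility;
  conjugate synchronization compatible with the log-link); the three approaches to cyclotomic rigidity
  (mono-theta / MLF-Galois pairs / number fields via `ℚ_{>0} ∩ Ẑ^× = {1}`), their (uni/multi)radiality
  and mutual compatibility. -/
  | vi
  /-- (vii) p. 179 l. 19 – p. 180 l. 10 (§B: 284 w): the `F^{⋊±}_l`- and `F^⋇_l`-symmetries are treated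
  separately; both compatible with vertical coricity and the Kummer isomorphisms; tautological
  multiradiality. -/
  | vii
  /-- (viii) p. 180 l. 11–20 (§B: 97 w): global ±-synchronization; profinite conjugacy indeterminacies
  resolved by [IUTchI] §2. -/
  | viii
  /-- (ix) p. 180 l. 21–42 (§B: 183 w): the copies of `F_mod` as translation apparatus; `F^⊛_MOD` vs
  `F^⊛_mod` ((Ind3), explicit estimates by log-volumes). -/
  | ix
  /-- (x) p. 180 l. 43 – p. 181 l. 32 (§B: 475 w): summary — Kummer-detachment at the cost of (Ind1),
  (Ind2), (Ind3); procession-normalized log-volumes as a "coarse space": invariant under (Ind1), (Ind2),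
  converting (Ind3) into an inequality from above; log-link compatibility; averages over `j`; tensor
  products identify multiplication by `ℤ` at different labels. -/
  | x
  /-- (xi-a) p. 181 l. 33–44 (§B: 12 + 112 w): the `q`-pilot object at (1,0) via holomorphic
  log-shells; the link as a gluing under which the Θ-pilot at (0,0) corresponds to the `q`-pilot at (1,0). -/
  | xi_a
  /-- (xi-b) p. 181 l. 45 – p. 182 l. 24 (§B: 301 w): the algorithm yields a collection of possibilities
  of output data in `^{0,∘}U ⥲ ^{1,∘}U` satisfying (IPL), (SHE); the `F^{⊩▶}` portion of the link is a full
  poly-isomorphism; only the qualitative (IPL), (SHE), (APT) are used ((HIS)). -/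
  | xi_b
  /-- (xi-c) p. 182 l. 25–46 (§B: 257 w): the displayed summary; enlarging to the holomorphic hull gives
  output data in terms of localizations of arithmetic vector bundles. Note (ref PASS-R7 F5): the display
  opens with the unbracketed "The multiradial construction algorithm of Theorem 3.11" (p. 182 l. 27), which
  the data of (xi-b), (xi-d), (xi-e), (xi-g) count as `thm3_11_algo`; for (xi-c) the landed datum omits it
  (gate append-only) and `xi_c_thm3_11_algo_via_xi_b` records that the locus reaches (xi-c) through (xi-b). -/
  | xi_c
  /-- (xi-d) p. 183 l. 2–42 (§B: 416 w): the displayed conclusion after the hull; determinant +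
  normalized log-volume ⟹ "completely comparable objects … `ℝ_{≤−|log(Θ)|} := {λ ∈ ℝ | λ ≤ −|log(Θ)|}
  ⊆ ℝ; −|log(q)| ∈ ℝ`"; degrees as log-volumes; the 1-column log-Kummer correspondence rectifies the
  vertical shift. THE REAL NUMBERS ENTER HERE. -/
  | xi_d
  /-- (xi-e) p. 183 l. 43 – p. 184 l. 18 (§B: 179 w): (SHE) = expressibility "even when subject to the
  condition that the pilot-object log-volume … be equal to the fixed value `−|log(q)|`"; display:
  `ℝ_{≤−|log(Θ)|}` is "linked/related [cf. (IPL)], via isomorphisms of `F^{⊩▶}`-prime-strips, to …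
  `−|log(q)| ∈ ℝ`". -/
  | xi_e
  /-- (xi-f) p. 184 l. 19–29 (§B: 105 w; THE DISPUTED NODE — Scholze–Stix 2018 §2.2, LANA 2026 §8.3/(9-1)):
  "subject to the condition that [it] constitutes … a construction [perhaps only up to …
  "approximation" …] of … `−|log(q)|`. The inclusion `−|log(q)| ∈ ℝ_{≤−|log(Θ)|}`, hence also the
  inequality … then follows formally." -/
  | xi_f
  /-- (xi-g) p. 184 l. 30–34 + Fig. 3.8 p. 185 (§B: 261 w with (xi-h)): "two tautologically equivalent
  ways to compute the log-volume of the `q`-pilot object at (1,0)". -/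
  | xi_g
  /-- (xi-h) p. 185 l. 48–58: the argument depends on [EtTh] and has no evident `N`-th power
  generalization (`N ≥ 2`); the sharper inequalities are false ([IUTchIV] Rem. 2.3.2 (ii)). -/
  | xi_h
  /-- (xii) p. 185 l. 59 – p. 186 l. 3 (§B: 208 w): why global realified Frobenioids are needed (local
  Frobenioid objects are determined only up to `p_v^N`-multiples). -/
  | xii
  deriving DecidableEq, Repr

namespace Step

/-- The per-node data read on the page. [claim: Mochizuki2012, status: disputed] -/
structure Data where
  /-- position in the printed order (0 = opening paragraph, …, 19 = (xii)) -/
  idx : ℕ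
  /-- loci cited in the node -/
  cites : List Locus
  /-- earlier nodes referred back to -/
  after : List Step
  /-- earlier observations invoked -/
  uses : List Obs
  /-- observations drawn -/
  concl : List Obs

/-- Citations, back-references, invoked and drawn observations of each node, READ ON THE PAGE
(kurims pp. 174–186). [claim: Mochizuki2012, status: disputed] -/
def data : Step → Data
  | wlog => ⟨0, [chI_def3_1_b, thm3_11_i_a, def3_8_i, thm3_11_ii_a, Ind1, Ind2, Ind3, rem3_9_5_i,
      rem2_4_2, rem3_9_6, rem3_9_7, IPL], [], [], [restrictToStrips]⟩
  | i => ⟨1, [def3_8_ii, def2_4_iii, rem3_8_1], [], [], [linkSplits, valueGroupMapsPilots]⟩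
  | ii => ⟨2, [thm3_11_iii_a, thm3_11_iii_b, Ind1, Ind2, thm3_11_iii_c, thm3_11_iii_d, rem3_11_3, etTh,
      chI_ex5_1_v, chI_def5_2, prop3_4_ii, prop3_7_i, cor2_3, rem2_3_2, rem2_3_3], [], [],
      [unitsSubjectInd12, cyclotomesInsulated]⟩
  | iii => ⟨3, [rem3_11_3], [i], [], [singleLinkNecessary]⟩
  | iv => ⟨4, [thm1_5_iii, thm1_5_iv, rem3_11_3, rem1_2_2_iii, thm3_11_ii_a, thm3_11_ii_b, thm3_11_ii_c,
      Ind3], [iii], [singleLinkNecessary], [verticalShiftSolved]⟩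
  | v => ⟨5, [thm1_5_iii, thm1_5_iv, rem1_5_2, chII_rem4_11_2, rem1_5_4_i, thm3_11_ii_a, thm3_11_ii_b,
      thm3_11_ii_c], [i, iv], [linkSplits], [unitsRelatedContainers, frobeniusLikeRelatedToCoric]⟩
  | vi => ⟨6, [thm3_11_ii_b, thm3_11_ii_c, rem2_2_2_iii, rem2_3_2, prop3_4_ii, chII_sec3_cor3_5_3_6, etTh,
      rem2_1_1, rem2_3_3, chII_rem3_6_4, rem1_3_2, chII_cor1_11_a, chII_rem1_11_1, chII_prop4_2_i,
      absTopIII_prop3_2_iv, absAnab_prop1_2_1_vii, chII_prop4_4_i, chI_rem3_4_2, chI_ex5_1_v, chI_def5_2,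
      thm3_11_iii_d, rem3_11_3, chII_rem1_11_3], [v], [frobeniusLikeRelatedToCoric],
      [logKummerViaGaloisEvaluation, conjSyncLogLinkCompatible, cycRigidityApproaches]⟩
  | vii => ⟨7, [thm1_5_iii, thm1_5_iv, rem1_5_1, chI_sec4_5_6, chII_rem4_7_6, thm3_11_ii_b, thm3_11_ii_c,
      rem3_11_2], [vi], [cycRigidityApproaches], [symmetriesSeparate, symmetriesMultiradial]⟩
  | viii => ⟨8, [chII_sec2, chI_sec2, chI_rem6_12_4_iii, chII_rem4_5_3_iii, chII_rem4_11_2], [vii],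
      [symmetriesSeparate], [conjugacyIndetResolved]⟩
  | ix => ⟨9, [rem3_10_1, Ind3], [vii, v], [symmetriesSeparate, unitsRelatedContainers],
      [fmodTranslation]⟩
  | x => ⟨10, [rem1_5_4_i, rem2_1_1, rem3_10_1, thm3_11_ii_a, thm3_11_ii_b, thm3_11_ii_c, thm3_11_iii_a,
      thm3_11_iii_b, thm3_11_iii_c, thm3_11_iii_d, thm3_11_i_a, thm3_11_i_b, thm3_11_i_c, Ind1,
      thm3_11_i_perm, Ind2, Ind3, prop3_9_ii, prop3_9_iv, thm3_11_ii_logvol, chII_cor4_10_i, rem3_9_3],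
      [i, ii, iii, iv, v, vi, vii, viii, ix],
      [unitsSubjectInd12, cyclotomesInsulated, verticalShiftSolved, unitsRelatedContainers,
        frobeniusLikeRelatedToCoric, fmodTranslation],
      [kummerDetachmentInd123, logvolInvariantInequality, logvolLogLinkCompatible, tensorIdentifiesMultZ]⟩
  | xi_a => ⟨11, [rem3_12_2_iv, rem3_12_2_v, rem3_12_2_ii], [i], [valueGroupMapsPilots], [linkAsGluing]⟩
  | xi_b => ⟨12, [thm3_11_algo, thm3_11_i_perm, IPL, SHE, rem3_11_1_v, rem3_11_1_ii, Ind1, Ind2, Ind3,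
      APT, HIS], [x, wlog], [kummerDetachmentInd123, restrictToStrips],
      [outputSatisfiesIPLSHE, valueGroupLinkFullPolyIso, onlyQualitative]⟩
  | xi_c => ⟨13, [IPL, SHE, rem3_9_5_vii, rem3_12_2_v], [xi_b],
      [outputSatisfiesIPLSHE, valueGroupLinkFullPolyIso], [displayXIc, hullGivesVectorBundles]⟩
  | xi_d => ⟨14, [thm3_11_algo, IPL, SHE, rem3_9_5_vii, rem3_9_5_viii, rem3_9_5_ix, prop3_9_iii,
      rem3_9_2, rem3_9_6, rem1_5_2, rem3_10_1, rem3_12_2_v, rem3_9_5_x], [xi_c, iii, iv, wlog],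
      [displayXIc, hullGivesVectorBundles],
      [displayXId, comparableObjects, degreesAsLogVolumes, oneColumnLogKummerRectifies]⟩
  | xi_e => ⟨15, [SHE, IPL, thm3_11_algo], [xi_d], [displayXId, comparableObjects],
      [sheMeansFixedValue, displayXIe]⟩
  | xi_f => ⟨16, [], [xi_e], [displayXIe, sheMeansFixedValue], [constitutesConstruction]⟩
  | xi_g => ⟨17, [thm3_11_algo], [xi_f], [constitutesConstruction], [twoEquivalentWays]⟩
  | xi_h => ⟨18, [etTh, rem2_1_1, chII_rem3_6_4, chIV_rem2_3_2_ii], [ii, vi, xi_g],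
      [cyclotomesInsulated, logKummerViaGaloisEvaluation], [noNthPower]⟩
  | xii => ⟨19, [rem3_6_2_i], [xi_g], [], [globalFrobenioidsNeeded]⟩

/-- printed position -/
abbrev idx (s : Step) : ℕ := s.data.idx
/-- loci cited in the node -/
abbrev cites (s : Step) : List Locus := s.data.cites
/-- earlier nodes referred back to -/
abbrev after (s : Step) : List Step := s.data.after
/-- earlier observations invoked -/
abbrev uses (s : Step) : List Obs := s.data.uses
/-- observations drawn -/
abbrev concl (s : Step) : List Obs := s.data.concl

/-- All twenty nodes in printed order. [claim: Mochizuki2012, status: disputed] -/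
def all : List Step :=
  [wlog, i, ii, iii, iv, v, vi, vii, viii, ix, x, xi_a, xi_b, xi_c, xi_d, xi_e, xi_f, xi_g, xi_h, xii]

/-- The list is complete … [folklore] -/
theorem mem_all (s : Step) : s ∈ all := by cases s <;> decide

/-- … without repetition, of length 20 (§B: 19, folding (xi-h) into (xi-g)), and `idx` is the position. [folklore] -/
theorem all_nodup_length_idx : all.Nodup ∧ all.length = 20 ∧ all.map idx = List.range 20 := by decide

/-- The loci cited in the STATEMENT of Cor. 3.12 (p. 173 l. 41 – p. 174 l. 19): Rem 3.1.1 (ii)–(iv),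
Prop 3.9 (i), (ii), Thm 3.11 (i)(a), Rem 3.9.5 (i), Def 3.8 (i), Thm 3.11 (ii), (Ind1)–(Ind3),
[IUTchII] Cor 4.10 (i), [IUTchI] Def 3.1 (b). [claim: Mochizuki2012, status: disputed] -/
def statementCites : List Locus :=
  [rem3_1_1, prop3_9_i, prop3_9_ii, thm3_11_i_a, rem3_9_5_i, def3_8_i, thm3_11_ii_a, Ind1, Ind2, Ind3,
   chII_cor4_10_i, chI_def3_1_b]

/-! ## 2. The DAG is well formed (machine-checked bookkeeping) -/

/-- Back-references point backwards in the printed order. [folklore] -/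
theorem after_lt : ∀ s ∈ all, ∀ t ∈ s.after, t.idx < s.idx := by decide

/-- Every invoked observation was drawn by a node referred back to. [folklore] -/
theorem uses_supplied : ∀ s ∈ all, ∀ o ∈ s.uses, ∃ t ∈ s.after, o ∈ t.concl := by decide

/-- Every observation is drawn by exactly one node. [folklore] -/
theorem concl_unique : ∀ o ∈ Obs.all, (all.filter fun s => o ∈ s.concl).length = 1 := by decide

/-- Every one of the 85 loci is cited in the statement or in some node. [folklore] -/
theorem cites_cover : ∀ c ∈ Locus.all, c ∈ statementCites ∨ ∃ s ∈ all, c ∈ s.cites := by decide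

/-- CENSUS, sub-item loci cited per node, in printed order (opening ¶, (i), …, (xii)). The cell's regex
census (plan/STATEMENT-CLOSURE.md §B, numbered items incl. repeats) reads
`10·1·8·1·4·6·25·6·5·2·9·2·5·1·10·1·1·6·–·1`; the differences are the (Ind1)–(Ind3), (IPL)/(SHE)/
(APT)/(HIS) and Thm 3.11 sub-item loci counted here and the repeats counted there. [folklore] -/
theorem cites_lengths :
    all.map (fun s => s.cites.length) = [12, 3, 15, 1, 8, 8, 23, 8, 5, 2, 22, 3, 11, 4, 13, 3, 0, 1, 4, 1] := by
  decide

/-- (xi-f) cites nothing but (xi-e) (and the statement's own notation): the disputed node rests on no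
locus beyond those of (xi-e). [claim: Mochizuki2012, status: disputed] -/
theorem xi_f_data : xi_f.cites = [] ∧ xi_f.after = [xi_e] ∧ xi_f.uses = [displayXIe, sheMeansFixedValue] ∧
    xi_f.concl = [constitutesConstruction] := by decide

/-! ## 3. Nodes as inferences; the chain -/

/-- A node HOLDS under a reading (`L` = which cited loci one grants, `O` = which of the proof's
observations one grants) when: cited loci ∧ invoked earlier observations ⟹ the node's observations.
[claim: Mochizuki2012, status: disputed] -/
@[claim "Mochizuki2012" "disputed"] def Holds (s : Step) (L : Locus → Prop) (O : Obs → Prop) : Prop :=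
  (∀ c ∈ s.cites, L c) → (∀ o ∈ s.uses, O o) → ∀ o ∈ s.concl, O o

end Step

/-- THE CHAIN: all twenty nodes hold under the reading. [claim: Mochizuki2012, status: disputed] -/
@[claim "Mochizuki2012" "disputed"] def Chain (L : Locus → Prop) (O : Obs → Prop) : Prop := ∀ s : Step, s.Holds L O

/-- Every observation is drawn by some node (pointwise form of `Step.concl_unique`). [folklore] -/
theorem concl_cover (o : Obs) : ∃ s : Step, o ∈ s.concl := by
  have h : ∃ s ∈ Step.all, o ∈ s.concl := by cases o <;> decide
  obtain ⟨s, -, hs⟩ := h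
  exact ⟨s, hs⟩

/-- **Granting every cited locus, the chain yields every observation of the proof** — by induction
along the DAG (`Step.after_lt`, `Step.uses_supplied`); in particular it yields (xi-f)'s
`Obs.constitutesConstruction`. Kernel bookkeeping; the content is in `L`, `O` and the twenty
inferences. [claim: Mochizuki2012, status: disputed] -/
theorem obs_of_chain {L : Locus → Prop} {O : Obs → Prop} (hL : ∀ c, L c) (hC : Chain L O) (o : Obs) :
    O o := by
  suffices h : ∀ n : ℕ, ∀ s : Step, s.idx < n → ∀ o ∈ s.concl, O o by
    obtain ⟨s, hs⟩ := concl_cover o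
    exact h _ s (Nat.lt_succ_self _) o hs
  intro n
  induction n with
  | zero => intro s hs; exact absurd hs (Nat.not_lt_zero _)
  | succ n ih =>
    intro s hs o ho
    refine hC s (fun c _ => hL c) (fun o' ho' => ?_) o ho
    obtain ⟨t, ht, hto⟩ := Step.uses_supplied s (Step.mem_all s) o' ho'
    have hlt := Step.after_lt s (Step.mem_all s) t ht
    exact ih t (by omega) o' hto

/-- In particular the disputed node's conclusion. [claim: Mochizuki2012, status: disputed] -/
theorem constitutesConstruction_of_chain {L : Locus → Prop} {O : Obs → Prop} (hL : ∀ c, L c)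
    (hC : Chain L O) : O .constitutesConstruction :=
  obs_of_chain hL hC _

/-- NON-VACUITY (i): granting all observations, the chain holds under ANY reading of the loci — the
chain is satisfiable. [folklore] -/
theorem chain_of_grant (L : Locus → Prop) : Chain L (fun _ => True) :=
  fun _ _ _ _ _ => trivial

/-- NON-VACUITY (ii): the chain is not automatic — granting every locus and every observation EXCEPT
(xi-f)'s `constitutesConstruction` violates it (node (xi-f) infers it from (xi-e)). [folklore] -/
theorem not_chain_denying_xi_f :
    ¬ Chain (fun _ => True) (fun o => o ≠ .constitutesConstruction) := by
  intro h
  exact h .xi_f (fun _ _ => trivial) (by decide) .constitutesConstruction (by decide) rfl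

/-- Conversely, denying a LOCUS blocks exactly the nodes citing it: e.g. with [EtTh] not granted, node
(ii) holds vacuously whatever one says about its observations. [folklore] -/
theorem holds_ii_of_not_etTh {L : Locus → Prop} (h : ¬ L .etTh) (O : Obs → Prop) : Step.ii.Holds L O :=
  fun hc => absurd (hc .etTh (by decide)) h

/-- Ref PASS-R7 F5, as a kernel fact instead of a mutation of the landed datum: (xi-c)'s own `cites` omit
`thm3_11_algo` (its display's opening phrase is unbracketed), while (xi-b) — which (xi-c) refers back to and
whose observations it invokes — cites it; so the locus reaches (xi-c) one step upstream (cf.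
`Cor312Least.Step.upstreamLoci`). [folklore] -/
theorem xi_c_thm3_11_algo_via_xi_b :
    thm3_11_algo ∉ Step.xi_c.cites ∧ thm3_11_algo ∈ Step.xi_b.cites ∧ Step.xi_b ∈ Step.xi_c.after ∧
      (∀ o ∈ Step.xi_c.uses, o ∈ Step.xi_b.concl) := by
  decide

/-- **Corrected citation datum (ref PASS-R7 F5 / R8), deprecate-and-add:** `Step.cites'` = `Step.cites` except that
(xi-c) also carries `thm3_11_algo` (its display opens with the unbracketed "The multiradial construction algorithm of
Theorem 3.11", p. 182 l. 27, counted by the same convention as at (xi-b), (xi-d), (xi-e), (xi-g)). The landed `Step.cites`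
/ `Step.data` stay as filed (gate append-only); `Step.Holds` keeps using `cites` — for (xi-c) this only WEAKENS the premise
set of its inference (one locus fewer), harmless for `obs_of_chain` and for the upstream counts of `Cor312Least`
(`thm3_11_algo` reaches (xi-c) through (xi-b), `xi_c_thm3_11_algo_via_xi_b`). [claim: Mochizuki2012, status: disputed] -/
def Step.cites' (s : Step) : List Locus :=
  match s with
  | .xi_c => [thm3_11_algo, IPL, SHE, rem3_9_5_vii, rem3_12_2_v]
  | s => s.cites

/-- `cites'` differs from `cites` exactly at (xi-c). [folklore] -/
theorem Step.cites'_eq_cites : ∀ s ∈ Step.all, s ≠ .xi_c → s.cites' = s.cites := by decide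

/-- CENSUS with the corrected datum: sub-item loci cited per node = `12·3·15·1·8·8·23·8·5·2·22·3·11·5·13·3·0·1·4·1`
((xi-c): 5, as ref PASS-R7 F5 reads the page). [folklore] -/
theorem Step.cites'_lengths :
    Step.all.map (fun s => s.cites'.length) = [12, 3, 15, 1, 8, 8, 23, 8, 5, 2, 22, 3, 11, 5, 13, 3, 0, 1, 4, 1] := by
  decide

/-- Every locus is still cited (statement or some node) under `cites'`. [folklore] -/
theorem Step.cites'_cover : ∀ c ∈ Locus.all, c ∈ Step.statementCites ∨ ∃ s ∈ Step.all, c ∈ s.cites' := by decide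

end Cor312Proof

end IUTFork

end Summit.ABC
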